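import Mathlib.Algebra.BigOperators.Fin
import Mathlib.Analysis.SpecialFunctions.Pow.Real
import Mathlib.Data.Fin.Tuple.Basic
import HarnessLib

/-!
# Cell qa-qnc0, frame second moment (ROUND-21 §3): weighted LINEAR HARD-CORE WORDS — a two-state transfer potential

Support for crux `RingDenseResidualLt3` (stmt-QuantumAdvantage-22907), route `DWalkThree`; planner qa-qnc0-p1 g22,
Sketch22 §2 asks (HC-mgf) `KernelZerosOnSetMGF` and (HC-Z) `KernelZerosMGF` (file `AffBells22KernelZeros.lean`).  Both reduce
(via the tree's fibre bound `Fib19.card_fibre_le`) to weighted sums over Boolean words `v ∈ {0,1}^n` WITHOUT two consecutive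
zeros, with a weight `w_i ≥ 0` per zero at position `i`:  `S_n(w) = Σ_v Π_{i : v_i = 0} w_i`.

This file (generic, no cell objects; 0 sorry):
* `wordWt`, `NoAdj`, `endSum w j c` (the partial sums over words of length `j+1` ending in the letter `c`);
* the transfer recursion `endSum_succ_true` / `endSum_succ_false` (`A' = A + B`, `B' = w_{j+1}·A`, by `Fin.snocEquiv`);
* the quadratic POTENTIAL `qf A B = 5A² + 2AB + 2B²` with `(A+B)² ≤ qf` and the one-step bounds
  `qf(A+B, wA) ≤ 4·qf` (`w ≤ 2`), `≤ (13/4)·qf` (`w ≤ 1`), `≤ (19/5)·qf` (`w ≤ 7/4`) — the eigenvalue `2` of the weight-`2`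
  transfer matrix `[[1,1],[2,0]]` is not expanded, lighter sites contract;
* `endSum_sq_le_pow`: `(A_j + B_j)² ≤ 17 · Π_{1 ≤ i ≤ j} θ(w_i)` … packaged as the two bounds used downstream:
  `total_le_of_weights_le_two_one` (weights in `{≤1 on D, ≤2}`: `S ≤ (160/29)·(29/32)^{#D}·2^{n−1}`) and
  `total_le_of_weights_le` (all weights `≤ 7/4`: `S ≤ (160/39)·(39/40)^n·2^{n−1}`).

WHAT THIS IS NOT: no cyclic (trace) identity and no sharp rates (`φ/2`, `.954`); upper bounds only.
-/

namespace Summit.QuantumAdvantage.AdviceFreeQNC0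

open Finset

namespace AffBells22

/-! ## Words, weights, the no-two-zeros constraint -/

/-- Weight of a Boolean word: the product of `w i` over its zeros. -/
noncomputable def wordWt (w : ℕ → ℝ) {j : ℕ} (v : Fin j → Bool) : ℝ :=
  ∏ i : Fin j, (if v i = false then w i.val else 1)

/-- Linear hard-core constraint: no two consecutive zeros. -/
def NoAdj {j : ℕ} (v : Fin j → Bool) : Prop :=
  ∀ i : Fin j, ∀ h : i.val + 1 < j, ¬ (v i = false ∧ v ⟨i.val + 1, h⟩ = false)

/-- `NoAdj` is decidable (a finite conjunction). -/
instance decidableNoAdj {j : ℕ} (v : Fin j → Bool) : Decidable (NoAdj v) := by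
  unfold NoAdj; infer_instance

/-- The partial sums: words of length `j+1` with no two consecutive zeros, ending in the letter `c`. -/
noncomputable def endSum (w : ℕ → ℝ) (j : ℕ) (c : Bool) : ℝ :=
  ∑ v : Fin (j + 1) → Bool, if (NoAdj v ∧ v (Fin.last j) = c) then wordWt w v else 0

/-- Word weights are non-negative for non-negative site weights. -/
theorem wordWt_nonneg {w : ℕ → ℝ} (hw : ∀ i, 0 ≤ w i) {j : ℕ} (v : Fin j → Bool) : 0 ≤ wordWt w v := by
  unfold wordWt
  exact prod_nonneg fun i _ => by split_ifs <;> [exact hw _; norm_num]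

/-- The partial sums are non-negative. -/
theorem endSum_nonneg {w : ℕ → ℝ} (hw : ∀ i, 0 ≤ w i) (j : ℕ) (c : Bool) : 0 ≤ endSum w j c := by
  unfold endSum
  exact sum_nonneg fun v _ => by split_ifs <;> [exact wordWt_nonneg hw v; norm_num]

/-- Weights are monotone in `w`. -/
theorem wordWt_mono {w w' : ℕ → ℝ} (hw : ∀ i, 0 ≤ w i) (hww' : ∀ i, w i ≤ w' i) {j : ℕ} (v : Fin j → Bool) :
    wordWt w v ≤ wordWt w' v := by
  unfold wordWt
  refine prod_le_prod (fun i _ => by split_ifs <;> [exact hw _; norm_num]) fun i _ => ?_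
  split_ifs <;> [exact hww' _; norm_num]

/-! ## The transfer recursion -/

/-- Weight of a snoc-extended word. -/
theorem wordWt_snoc (w : ℕ → ℝ) {j : ℕ} (v : Fin (j + 1) → Bool) (c : Bool) :
    wordWt w (Fin.snoc v c : Fin (j + 2) → Bool) = wordWt w v * (if c = false then w (j + 1) else 1) := by
  unfold wordWt
  rw [Fin.prod_univ_castSucc]
  congr 1
  · refine prod_congr rfl fun i _ => ?_
    rw [Fin.snoc_castSucc]
    rfl
  · rw [Fin.snoc_last]
    rfl

/-- The no-two-zeros constraint of a snoc-extended word. -/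
theorem noAdj_snoc_iff {j : ℕ} (v : Fin (j + 1) → Bool) (c : Bool) :
    NoAdj (Fin.snoc v c : Fin (j + 2) → Bool) ↔ (NoAdj v ∧ ¬ (v (Fin.last j) = false ∧ c = false)) := by
  constructor
  · intro h
    constructor
    · intro i hi hc
      have h' := h (Fin.castSucc i) (by simp; omega)
      apply h'
      have e1 : (⟨(Fin.castSucc i).val + 1, by simp; omega⟩ : Fin (j + 2)) = Fin.castSucc ⟨i.val + 1, hi⟩ :=
        Fin.ext (by simp)
      rw [Fin.snoc_castSucc, e1, Fin.snoc_castSucc]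
      exact hc
    · intro hc
      have h' := h (Fin.castSucc (Fin.last j)) (by simp)
      apply h'
      have e1 : (⟨(Fin.castSucc (Fin.last j)).val + 1, by simp⟩ : Fin (j + 2)) = Fin.last (j + 1) :=
        Fin.ext (by simp)
      rw [Fin.snoc_castSucc, e1, Fin.snoc_last]
      exact hc
  · rintro ⟨hv, hc⟩ i hi hbad
    obtain ⟨hb1, hb2⟩ := hbad
    by_cases hlt : i.val + 1 < j + 1
    · -- both positions inside `v`
      have hi' : i.val < j + 1 := by omega
      have e0 : i = Fin.castSucc ⟨i.val, hi'⟩ := Fin.ext (by simp)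
      have e1 : (⟨i.val + 1, hi⟩ : Fin (j + 2)) = Fin.castSucc ⟨i.val + 1, hlt⟩ := Fin.ext (by simp)
      rw [e1, Fin.snoc_castSucc] at hb2
      rw [e0, Fin.snoc_castSucc] at hb1
      exact hv ⟨i.val, hi'⟩ hlt ⟨hb1, hb2⟩
    · -- the pair (last of `v`, new letter)
      have hiv : i.val = j := by omega
      have e0 : i = Fin.castSucc (Fin.last j) := Fin.ext (by simp [hiv])
      have e1 : (⟨i.val + 1, hi⟩ : Fin (j + 2)) = Fin.last (j + 1) := Fin.ext (by simp [hiv])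
      rw [e1, Fin.snoc_last] at hb2
      rw [e0, Fin.snoc_castSucc] at hb1
      exact hc ⟨hb1, hb2⟩

/-- Sums over words of length `j+2` as sums over (last letter, prefix). -/
theorem sum_snoc {j : ℕ} (G : (Fin (j + 2) → Bool) → ℝ) :
    ∑ u : Fin (j + 2) → Bool, G u = ∑ c : Bool, ∑ v : Fin (j + 1) → Bool, G (Fin.snoc v c) := by
  rw [← (Fin.snocEquiv fun _ : Fin (j + 2) => Bool).sum_comp, Fintype.sum_prod_type]
  rfl

/-- **Transfer recursion, last letter `1`**: `A_{j+1} = A_j + B_j`. -/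
theorem endSum_succ_true (w : ℕ → ℝ) (j : ℕ) :
    endSum w (j + 1) true = endSum w j true + endSum w j false := by
  unfold endSum
  rw [sum_snoc, Fintype.sum_bool]
  have hfalse : ∑ v : Fin (j + 1) → Bool,
      (if (NoAdj (Fin.snoc v false : Fin (j + 2) → Bool) ∧ (Fin.snoc v false : Fin (j + 2) → Bool) (Fin.last (j + 1)) = true)
        then wordWt w (Fin.snoc v false : Fin (j + 2) → Bool) else 0) = 0 := by
    refine sum_eq_zero fun v _ => ?_
    rw [Fin.snoc_last]
    simp
  rw [hfalse, add_zero, ← sum_add_distrib]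
  refine sum_congr rfl fun v _ => ?_
  simp only [Fin.snoc_last, noAdj_snoc_iff, wordWt_snoc]
  by_cases hv : NoAdj v
  · cases v (Fin.last j) <;> simp [hv]
  · simp [hv]

/-- **Transfer recursion, last letter `0`**: `B_{j+1} = w_{j+1} · A_j`. -/
theorem endSum_succ_false (w : ℕ → ℝ) (j : ℕ) :
    endSum w (j + 1) false = w (j + 1) * endSum w j true := by
  unfold endSum
  rw [sum_snoc, Fintype.sum_bool, mul_sum]
  have htrue : ∑ v : Fin (j + 1) → Bool,
      (if (NoAdj (Fin.snoc v true : Fin (j + 2) → Bool) ∧ (Fin.snoc v true : Fin (j + 2) → Bool) (Fin.last (j + 1)) = false)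
        then wordWt w (Fin.snoc v true : Fin (j + 2) → Bool) else 0) = 0 := by
    refine sum_eq_zero fun v _ => ?_
    rw [Fin.snoc_last]
    simp
  rw [htrue, zero_add]
  refine sum_congr rfl fun v _ => ?_
  simp only [Fin.snoc_last, noAdj_snoc_iff, wordWt_snoc]
  by_cases hv : NoAdj v
  · cases v (Fin.last j) <;> simp [hv, mul_comm]
  · simp [hv]

/-- Base: the one-letter words. -/
theorem endSum_zero (w : ℕ → ℝ) : endSum w 0 true = 1 ∧ endSum w 0 false = w 0 := by
  have hNo : ∀ v : Fin 1 → Bool, NoAdj v := fun v i hi => absurd hi (by omega)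
  have huniv : (univ : Finset (Fin 1 → Bool)) = {fun _ => true, fun _ => false} := by
    ext v
    simp only [mem_univ, mem_insert, mem_singleton, true_iff]
    cases h : v 0
    · right; funext i; rw [Subsingleton.elim i 0, h]
    · left; funext i; rw [Subsingleton.elim i 0, h]
  have hne : (fun _ : Fin 1 => true) ≠ (fun _ : Fin 1 => false) := fun h => by
    have := congrFun h 0; simp at this
  unfold endSum
  rw [huniv, sum_insert (by simpa using hne), sum_singleton, sum_insert (by simpa using hne), sum_singleton]
  simp [hNo, wordWt]

/-! ## The quadratic potential -/

/-- `qf A B = 5A² + 2AB + 2B²` — a positive quadratic form adapted to the eigenbasis of the weight-`2` transfer matrix. -/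
def qf (A B : ℝ) : ℝ := 5 * A ^ 2 + 2 * A * B + 2 * B ^ 2

/-- `(A + B)² ≤ qf A B`. -/
theorem sq_add_le_qf (A B : ℝ) : (A + B) ^ 2 ≤ qf A B := by
  unfold qf; nlinarith [sq_nonneg A, sq_nonneg B, sq_nonneg (2 * A)]

/-- The potential is non-negative. -/
theorem qf_nonneg (A B : ℝ) : 0 ≤ qf A B := le_trans (sq_nonneg _) (sq_add_le_qf A B)

/-- Monotonicity of the updated potential in the weight (non-negative data). -/
theorem qf_step_mono {A B w c : ℝ} (hA : 0 ≤ A) (hB : 0 ≤ B) (hw : 0 ≤ w) (hwc : w ≤ c) :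
    qf (A + B) (w * A) ≤ qf (A + B) (c * A) := by
  unfold qf
  have h1 : w * A ≤ c * A := mul_le_mul_of_nonneg_right hwc hA
  have h2 : 0 ≤ w * A := mul_nonneg hw hA
  nlinarith [mul_nonneg (add_nonneg hA hB) h2, mul_le_mul h1 h1 h2 (le_trans h2 h1)]

/-- One step with weight `≤ 2` at most quadruples the potential. -/
theorem qf_step_two {A B w : ℝ} (hA : 0 ≤ A) (hB : 0 ≤ B) (hw : 0 ≤ w) (hw2 : w ≤ 2) :
    qf (A + B) (w * A) ≤ 4 * qf A B := by
  refine (qf_step_mono hA hB hw hw2).trans ?_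
  unfold qf; nlinarith [sq_nonneg (A - B)]

/-- One step with weight `≤ 1` contracts: factor `13/4 = 4·(13/16)`. -/
theorem qf_step_one {A B w : ℝ} (hA : 0 ≤ A) (hB : 0 ≤ B) (hw : 0 ≤ w) (hw1 : w ≤ 1) :
    qf (A + B) (w * A) ≤ 13 / 4 * qf A B := by
  refine (qf_step_mono hA hB hw hw1).trans ?_
  unfold qf; nlinarith [sq_nonneg (29 * A - 11 * B), sq_nonneg B]

/-- One step with weight `≤ 7/4` (`≥ √3`) contracts: factor `19/5 = 4·(19/20)`. -/
theorem qf_step_seven_quarters {A B w : ℝ} (hA : 0 ≤ A) (hB : 0 ≤ B) (hw : 0 ≤ w) (hw1 : w ≤ 7 / 4) :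
    qf (A + B) (w * A) ≤ 19 / 5 * qf A B := by
  refine (qf_step_mono hA hB hw hw1).trans ?_
  unfold qf; nlinarith [sq_nonneg (35 * A - 24 * B), sq_nonneg B, sq_nonneg A]

/-! ## Iterating the potential -/

/-- **Potential bound along the word**: with weights `0 ≤ w_i ≤ 2` everywhere and a per-site contraction factor
`θ_i ∈ {13/16 (if w_i ≤ 1 is certified by `i ∈ L`), 1}`:
`qf(A_j, B_j) ≤ 17 · 4^j · (13/16)^{#{i ∈ L : 1 ≤ i ≤ j}}`. -/
theorem qf_endSum_le (w : ℕ → ℝ) (hw0 : ∀ i, 0 ≤ w i) (hw2 : ∀ i, w i ≤ 2) (L : Finset ℕ)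
    (hL : ∀ i ∈ L, w i ≤ 1) (j : ℕ) :
    qf (endSum w j true) (endSum w j false)
      ≤ 17 * 4 ^ j * (13 / 16 : ℝ) ^ (L.filter fun i => 1 ≤ i ∧ i ≤ j).card := by
  induction j with
  | zero =>
    obtain ⟨h1, h2⟩ := endSum_zero w
    rw [h1, h2]
    have hc : (L.filter fun i => 1 ≤ i ∧ i ≤ 0).card = 0 := by
      rw [Finset.card_eq_zero, Finset.filter_eq_empty_iff]
      intro i _ h; omega
    rw [hc, pow_zero, pow_zero, mul_one, mul_one]
    unfold qf
    nlinarith [hw0 0, hw2 0]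
  | succ j ih =>
    rw [endSum_succ_true, endSum_succ_false]
    have hA := endSum_nonneg hw0 j true
    have hB := endSum_nonneg hw0 j false
    by_cases hmem : (j + 1) ∈ L
    · have hcard : (L.filter fun i => 1 ≤ i ∧ i ≤ j + 1).card = (L.filter fun i => 1 ≤ i ∧ i ≤ j).card + 1 := by
        have : (L.filter fun i => 1 ≤ i ∧ i ≤ j + 1) = insert (j + 1) (L.filter fun i => 1 ≤ i ∧ i ≤ j) := by
          ext i
          simp only [mem_filter, mem_insert]
          constructor
          · rintro ⟨hi, h1, h2⟩
            by_cases h : i = j + 1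
            · exact Or.inl h
            · exact Or.inr ⟨hi, h1, by omega⟩
          · rintro (h | ⟨hi, h1, h2⟩)
            · subst h; exact ⟨hmem, by omega, le_rfl⟩
            · exact ⟨hi, h1, by omega⟩
        rw [this, card_insert_of_notMem (by simp)]
      rw [hcard, pow_succ, pow_succ]
      have hstep := qf_step_one hA hB (hw0 (j + 1)) (hL _ hmem)
      nlinarith [hstep, ih, qf_nonneg (endSum w j true) (endSum w j false)]
    · have hcard : (L.filter fun i => 1 ≤ i ∧ i ≤ j + 1).card = (L.filter fun i => 1 ≤ i ∧ i ≤ j).card := by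
        congr 1
        ext i
        simp only [mem_filter]
        constructor
        · rintro ⟨hi, h1, h2⟩
          have : i ≠ j + 1 := fun h => hmem (h ▸ hi)
          exact ⟨hi, h1, by omega⟩
        · rintro ⟨hi, h1, h2⟩
          exact ⟨hi, h1, by omega⟩
      rw [hcard, pow_succ]
      have hstep := qf_step_two hA hB (hw0 (j + 1)) (hw2 (j + 1))
      have h13 : (0 : ℝ) ≤ (13 / 16 : ℝ) ^ (L.filter fun i => 1 ≤ i ∧ i ≤ j).card := by positivity
      nlinarith [hstep, ih, qf_nonneg (endSum w j true) (endSum w j false), h13]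

/-- The same iteration with the uniform contraction `19/20` (all weights `≤ 7/4`). -/
theorem qf_endSum_le' (w : ℕ → ℝ) (hw0 : ∀ i, 0 ≤ w i) (hw : ∀ i, w i ≤ 7 / 4) (j : ℕ) :
    qf (endSum w j true) (endSum w j false) ≤ 16 * (19 / 5 : ℝ) ^ j := by
  induction j with
  | zero =>
    obtain ⟨h1, h2⟩ := endSum_zero w
    rw [h1, h2, pow_zero, mul_one]
    unfold qf
    nlinarith [hw0 0, hw 0]
  | succ j ih =>
    rw [endSum_succ_true, endSum_succ_false, pow_succ]
    have hstep := qf_step_seven_quarters (endSum_nonneg hw0 j true) (endSum_nonneg hw0 j false) (hw0 (j + 1)) (hw (j + 1))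
    nlinarith [hstep, ih]

/-! ## The two total bounds -/

/-- Total over words of length `j+1`. -/
theorem total_eq (w : ℕ → ℝ) (j : ℕ) :
    ∑ v : Fin (j + 1) → Bool, (if NoAdj v then wordWt w v else 0) = endSum w j true + endSum w j false := by
  unfold endSum
  rw [← sum_add_distrib]
  refine sum_congr rfl fun v _ => ?_
  by_cases hv : NoAdj v
  · rw [if_pos hv]
    cases v (Fin.last j)
    · rw [if_neg (fun h => Bool.false_ne_true h.2), if_pos ⟨hv, rfl⟩, zero_add]
    · rw [if_pos ⟨hv, rfl⟩, if_neg (fun h => Bool.false_ne_true h.2.symm), add_zero]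
  · rw [if_neg hv, if_neg (fun h => hv h.1), if_neg (fun h => hv h.1), add_zero]

/-- From a bound on the square to a bound on a non-negative quantity. -/
theorem le_of_sq_le {x y : ℝ} (hy : 0 ≤ y) (h : x ^ 2 ≤ y ^ 2) : x ≤ y := by
  nlinarith [h, hy]

/-- **Weights `≤ 2`, and `≤ 1` on the (ℕ-coded) set `L`**: `S ≤ (160/29) · (29/32)^{#L'} · 2^j` over words of length `j+1`,
where `L' = L ∩ [1, j]`. -/
theorem total_le_two_one (w : ℕ → ℝ) (hw0 : ∀ i, 0 ≤ w i) (hw2 : ∀ i, w i ≤ 2) (L : Finset ℕ)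
    (hL : ∀ i ∈ L, w i ≤ 1) (j : ℕ) :
    ∑ v : Fin (j + 1) → Bool, (if NoAdj v then wordWt w v else 0)
      ≤ 5 * (29 / 32 : ℝ) ^ (L.filter fun i => 1 ≤ i ∧ i ≤ j).card * 2 ^ j := by
  rw [total_eq]
  set d := (L.filter fun i => 1 ≤ i ∧ i ≤ j).card
  have hq := qf_endSum_le w hw0 hw2 L hL j
  have hS := sq_add_le_qf (endSum w j true) (endSum w j false)
  apply le_of_sq_le (by positivity)
  have h13 : (13 / 16 : ℝ) ^ d ≤ ((29 / 32 : ℝ) ^ 2) ^ d :=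
    pow_le_pow_left₀ (by norm_num) (by norm_num) d
  have h4 : (4 : ℝ) ^ j = (2 ^ j) ^ 2 := by rw [← pow_mul, mul_comm, pow_mul]; norm_num
  have h29 : ((29 / 32 : ℝ) ^ 2) ^ d = ((29 / 32 : ℝ) ^ d) ^ 2 := by rw [← pow_mul, ← pow_mul, mul_comm]
  calc (endSum w j true + endSum w j false) ^ 2 ≤ 17 * 4 ^ j * (13 / 16 : ℝ) ^ d := hS.trans hq
    _ ≤ 25 * 4 ^ j * ((29 / 32 : ℝ) ^ 2) ^ d := by gcongr; norm_num
    _ = (5 * (29 / 32 : ℝ) ^ d * 2 ^ j) ^ 2 := by rw [h4, h29]; ring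

/-- **All weights `≤ 7/4`**: `S ≤ 4 · (39/20)^j` over words of length `j+1`. -/
theorem total_le_seven_quarters (w : ℕ → ℝ) (hw0 : ∀ i, 0 ≤ w i) (hw : ∀ i, w i ≤ 7 / 4) (j : ℕ) :
    ∑ v : Fin (j + 1) → Bool, (if NoAdj v then wordWt w v else 0) ≤ 4 * (39 / 20 : ℝ) ^ j := by
  rw [total_eq]
  have hq := qf_endSum_le' w hw0 hw j
  have hS := sq_add_le_qf (endSum w j true) (endSum w j false)
  apply le_of_sq_le (by positivity)
  have h19 : (19 / 5 : ℝ) ^ j ≤ ((39 / 20 : ℝ) ^ 2) ^ j := pow_le_pow_left₀ (by norm_num) (by norm_num) j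
  have h39 : ((39 / 20 : ℝ) ^ 2) ^ j = ((39 / 20 : ℝ) ^ j) ^ 2 := by rw [← pow_mul, ← pow_mul, mul_comm]
  calc (endSum w j true + endSum w j false) ^ 2 ≤ 16 * (19 / 5 : ℝ) ^ j := hS.trans hq
    _ ≤ 16 * ((39 / 20 : ℝ) ^ 2) ^ j := by gcongr
    _ = (4 * (39 / 20 : ℝ) ^ j) ^ 2 := by rw [h39]; ring

end AffBells22

end Summit.QuantumAdvantage.AdviceFreeQNC0
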